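import Literature.MathematicalPhysics.QuantumFieldTheory.Balaban1983to89.B9Eq325QprimeSingleSiteZd
import Literature.MathematicalPhysics.QuantumFieldTheory.Balaban1983to89.B8Eq191FlatLettersCubeMember

/-!
# [B9] (3.18)–(3.19) «Λ_j = Ω_j^{(j)} ∖ Ω_{j+1}^{(j)}» AT THE CUBE MEMBER OF [B8] (1.131): n06-w4's block-geometry clause `LevelDisjoint L m Λ s`
# HOLDS for the truncated site classes `cubeLamS` of the cube tower `{□_j}` — BY NAME from the tower geometry of `B8Eq191FlatLettersCubeMember`

Cell `pub-ymgap`, seat `pub-ymgap-dag-n05-c` generation 15 (R134 N05 [B8] s1; trigger: dag-n06-w4 g2 INTENT-7, bus 2026-08-28 03:13Z, «for the cube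
members (`cubeLamS` …) it holds … your box arithmetic; I do NOT type the cube clause»).  `--supports stmt-QuantumFields-20542` (Literature lane; theorems
only, nothing re-declared).  [B8] = [Balaban1985RegularSpaces]; [B9] = [4] = [Balaban1985BackgroundPropagators]; [B6] = [Balaban1984PropagatorsII].

WHY.  `B9Eq325QGGQInvZd` (dag-n06-w4) makes the third operator `(Q′G′²Q′*)⁻¹` of [B9] (3.25) an object at the `ℤᵈ × 𝔸` carrier under the displayed
injectivity of `Q′*` («`Q′` is onto» — print's block geometry), and `B9Eq325QprimeSingleSiteZd` reduces that hypothesis, for EVERY background of units, to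
the pure block-geometry clause `LevelDisjoint L m Λ s`: every constraint point `(j, y)` (`j ≤ m`, `y ∈ Λ_j`) owns a site `x` of the finite carrier `s`
(`= Ω₀`) in its level-`j` block (`blockMap^[j] x = y`) whose level-`i` block labels avoid every OTHER constraint point `(i, y′)`.  Deriving the clause for a
member class is «the law owners'».  At the cube member of (1.131) — `Ω₀ = □₀ = cubeFam false L a M ρ k 0`, truncated site classes
`Λ_j = cubeLamS L a M ρ k m j` (`Λ_j = □_j^{(j)} ∖ □_{j+1}^{(j)}` below the truncation level `m`, `□_m^{(m)}` at `j = m`; `B8CubeMemberZd`) — the owner is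
this seat, and the two geometric inputs are ALREADY tree theorems (dag-n05-e g3, `B8Eq191FlatLettersCubeMember` §1): `tower_meets_cube` (the corner
`Lʲ•y ∈ □_j ⊂ □₀` lies under `y`) and `towers_disjoint_cube` (a fine site under two constraint points sees the same point: the tower blocks over
`𝔅_m` are pairwise disjoint — [B8] (1.5)–(1.6), «□_{j+1} is a sum of the big blocks», p. 98).  THIS FILE assembles them into n06-w4's clause, SHAPE-FREE:
for ANY finset presentation `Λ` of sub-classes of the truncated classes (`↑(Λ j) ⊆ cubeLamS … m j`, `j ≤ m ≤ k`) and ANY finite carrier `s ⊇ □₀`.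

CONTENTS.  §1 ★★ `levelDisjoint_of_subset_cubeLamS` (the shape-free law), ★ `levelDisjoint_cubeLamS` (canonical finsets `Λ_j := cubeLamS … m j`, `s := □₀`),
`levelDisjoint_cubeLamS_of_supset` (canonical classes, any `s ⊇ □₀`), `levelDisjoint_cubeLamS_top` (A6: the untruncated (1.131) classes, `m = k`).
§2 MEMBER presentations for the cube sub-family's consumer index (`i : ZdIdx d L` with `i.Λs = cubeLamS L a M ρ i.k`, `i.Ω = cubeFam false L a M ρ i.k` —
the `B8CubeMemberZd.exists_member_cube` member): `levelDisjoint_of_subset_Λs_of_eq`, `levelDisjoint_of_subset_Λs_of_eq'` (carrier spelled `s ⊇ i.Ω 0`).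
§3 THE CONSEQUENCES AT THE CUBE MEMBER, BY NAME through n06-w4's `separatingSites_of_levelDisjoint ∕ qprimeStarInjective_of_levelDisjoint`: for EVERY background
of units `U₀`, ★ `separatingSites_of_subset_cubeLamS` ∕ `separatingSites_cubeLamS` ([B9] (3.18)–(3.19): the constraint points of the cube member are separated
by sites of `□₀`), and — Hermitian faithful `τ`, finite-dimensional `𝔸` — ★★ `qprimeStarInjective_of_subset_cubeLamS` ∕ `qprimeStarInjective_cubeLamS`
(«`Q′` is onto»: `Q′*` is injective on the level data `L²(𝔅_m, ·)` of the cube member), the displayed hypothesis `hinj` of `B9Eq325QGGQInvZd.qggq_bijective ∕ cZd`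
(Thm 3.11's third operator `(Q′G′²Q′*)⁻¹`) and of `B9Eq325ProjFormulaZd` ((3.25)) — so those hold at the cube member with NO geometric hypothesis displayed.
REUSED BY NAME: `B8Eq191FlatLettersCubeMember.tower_meets_cube ∕ towers_disjoint_cube ∕ cubeLamS_finite ∕ cubeFam_zero_finite`,
`B9Eq325QprimeSingleSiteZd.LevelDisjoint ∕ blockMapIter ∕ blockMapIter_eq_blockMap_pow ∕ separatingSites_of_levelDisjoint ∕ qprimeStarInjective_of_levelDisjoint`,
`B9Eq325QGGQInvZd.SeparatingSites ∕ QprimeStarInjective`.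

HONEST FRAMING.  Lattice bookkeeping of the cube tower `{□_j}_{j=0}^{k}` of (1.131), BY NAME; NO estimate, no definition, no literature fact introduced.
With n06-w4's `qprimeStarInjective_of_levelDisjoint` it yields «`Q′*` injective» ∕ `(Q′G′²Q′*)⁻¹` an object at the cube member for every unitary `U₀`
(Hermitian faithful `τ`, finite-dimensional `𝔸`) — print's UNIFORM statement (constants, [B9] Thm 3.1) is NOT claimed; count-neutral; N05 ∕ N06 NOT
discharged by this file; one finite 𝕋⁴ programme at fixed `ε = L^{−K}`, Bałaban AS PRINTED — nothing continuum ∕ ℝ⁴ ∕ OS ∕ mass-gap ∕ Clay.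
No `sorry`, no `instance`, no `notation`; standard axioms.
-/


namespace Literature.MathematicalPhysics.QuantumFieldTheory.Balaban1983to89.B8CubeMemberLevelDisjoint

open B7Prop1Explicit
open B8Eq131CubesAdmissible (cubeFam)
open B8CubeMemberZd (cubeLamS cubeLamS_top)
open B8Eq191FlatLettersCubeMember (tower_meets_cube towers_disjoint_cube cubeLamS_finite cubeFam_zero_finite)
open B9Eq325QGGQInvZd (SeparatingSites QprimeStarInjective)
open B9Eq325QprimeSingleSiteZd (blockMapIter blockMapIter_eq_blockMap_pow LevelDisjoint separatingSites_of_levelDisjoint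
  qprimeStarInjective_of_levelDisjoint)
open Literature.MathematicalPhysics.QuantumLattice (blockMap)
open B8LeafModelZd (ZdIdx)

-- `Site` alone could resolve to the torus sites of `Setup.lean`; re-export the `ℤ^d` sites of `B7Prop1Explicit`.
export B7Prop1Explicit (Site)

variable {d : ℕ}

/-! ## §1 `LevelDisjoint` at the cube member of (1.131) -/

/-- ★★ **THE CUBE CLAUSE, SHAPE-FREE.**  For the cube tower `{□_j}_{j=0}^{k}` of (1.131) (`1 ≤ L ≤ ρ`), every truncation `m ≤ k`, EVERY finset
presentation `Λ` of sub-classes of the truncated site classes (`y ∈ Λ j ⇒ y ∈ cubeLamS L a M ρ k m j` for `j ≤ m`) and EVERY finite carrier `s ⊇ □₀`,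
n06-w4's block-geometry clause `LevelDisjoint L m Λ s` holds: the constraint point `(j, y)` owns the corner `x := Lʲ•y ∈ □_j ⊂ □₀` of its block
(`tower_meets_cube`), and if the level-`i` block label of `x` were another constraint point `(i, y′)` then the tower blocks over `(j, y)` and `(i, y′)`
would share the fine site `x`, whence `(i, y′) = (j, y)` (`towers_disjoint_cube` — [B8] (1.5)–(1.6): «Λ_j = Ω_j^{(j)} ∖ Ω_{j+1}^{(j)}», «□_{j+1} is a sum
of the big blocks of the lattice T_{L^{−j}}»).  This is the «law owners'» input under which `B9Eq325QprimeSingleSiteZd.qprimeStarInjective_of_levelDisjoint`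
makes `Q′*` injective ∕ `(Q′G′²Q′*)⁻¹` an object ([B9] (3.25), Thm 3.11) at the cube member for every background of units.
[cite: Balaban1985BackgroundPropagators, (3.18)–(3.19) p.393, (3.25) p.394; Balaban1985RegularSpaces, (1.5)–(1.6) p.77, (1.68) p.88, (1.131) p.99, p.98] -/
theorem levelDisjoint_of_subset_cubeLamS {L : ℕ} (hL : 1 ≤ L) (a : Site d) (M : ℕ) {ρ : ℕ} (hρ : L ≤ ρ) {k m : ℕ} (hm : m ≤ k)
    {Λ : ℕ → Finset (Site d)} {s : Finset (Site d)} (hΛ : ∀ j, j ≤ m → ∀ y ∈ Λ j, y ∈ cubeLamS L a M ρ k m j)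
    (hs : cubeFam false L a M ρ k 0 ⊆ ↑s) : LevelDisjoint L m Λ s := by
  intro j hj y hy
  have hjm : j ≤ m := Nat.lt_succ_iff.mp (Finset.mem_range.mp hj)
  have hyS : y ∈ cubeLamS L a M ρ k m j := hΛ j hjm y hy
  obtain ⟨x, hx0, hxy⟩ := tower_meets_cube hL a M hρ hm j hjm y hyS
  refine ⟨x, hs hx0, ?_, ?_⟩
  · rw [blockMapIter_eq_blockMap_pow]; exact hxy
  · intro i hi y' hy' hne hxy'
    have him : i ≤ m := Nat.lt_succ_iff.mp (Finset.mem_range.mp hi)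
    rw [blockMapIter_eq_blockMap_pow] at hxy'
    obtain ⟨hji, hyy⟩ := towers_disjoint_cube hL a M hρ hm j hjm i him y hyS y' (hΛ i him y' hy') x hx0 hxy hxy'
    exact hne (Prod.ext hji.symm hyy.symm)

/-- ★ **THE CUBE CLAUSE AT THE CANONICAL FINSETS** `Λ_j := cubeLamS L a M ρ k m j` (finite: `B8Eq191FlatLettersCubeMember.cubeLamS_finite`),
`s := □₀ = cubeFam false L a M ρ k 0` (finite: `cubeFam_zero_finite`): `LevelDisjoint L m Λ □₀` for every truncation `m ≤ k` (`1 ≤ L ≤ ρ`).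
[cite: Balaban1985BackgroundPropagators, (3.18)–(3.19) p.393; Balaban1985RegularSpaces, (1.5)–(1.6) p.77, (1.68) p.88, (1.131) p.99] -/
theorem levelDisjoint_cubeLamS {L : ℕ} (hL : 1 ≤ L) (a : Site d) (M : ℕ) {ρ : ℕ} (hρ : L ≤ ρ) {k m : ℕ} (hm : m ≤ k) :
    LevelDisjoint L m (fun j => (cubeLamS_finite L a M ρ k m j).toFinset) (cubeFam_zero_finite L a M ρ k).toFinset :=
  levelDisjoint_of_subset_cubeLamS hL a M hρ hm (fun _ _ _ hy => (Set.Finite.mem_toFinset _).mp hy)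
    (fun x hx => by rw [Finset.mem_coe]; exact (Set.Finite.mem_toFinset _).mpr hx)

/-- **The canonical classes on ANY finite carrier holding `□₀`** (e.g. a consumer's larger box of `ℤᵈ`): `LevelDisjoint L m (cubeLamS … m ·) s` for every
finset `s ⊇ □₀`, `m ≤ k`, `1 ≤ L ≤ ρ`. [cite: Balaban1985BackgroundPropagators, (3.18)–(3.19) p.393; Balaban1985RegularSpaces, (1.5)–(1.6) p.77, (1.131) p.99] -/
theorem levelDisjoint_cubeLamS_of_supset {L : ℕ} (hL : 1 ≤ L) (a : Site d) (M : ℕ) {ρ : ℕ} (hρ : L ≤ ρ) {k m : ℕ} (hm : m ≤ k)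
    {s : Finset (Site d)} (hs : cubeFam false L a M ρ k 0 ⊆ ↑s) :
    LevelDisjoint L m (fun j => (cubeLamS_finite L a M ρ k m j).toFinset) s :=
  levelDisjoint_of_subset_cubeLamS hL a M hρ hm (fun _ _ _ hy => (Set.Finite.mem_toFinset _).mp hy) hs

/-- **A6 ∕ THE UNTRUNCATED CLASSES** (`m = k`, print's (1.131): `Λ′_j = □_j^{(j)} ∖ □_{j+1}^{(j)}` for `j < k`, `Λ′_k = □_k^{(k)}`; `cubeLamS … k j =
cubeLam … j`, `B8CubeMemberZd.cubeLamS_top`): `LevelDisjoint L k (cubeLamS … k ·) □₀` — the hypothesis class of n06-w4's §2 is inhabited by print's own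
geometry at every depth `k`. [cite: Balaban1985RegularSpaces, (1.131) p.99, (1.5)–(1.6) p.77; Balaban1985BackgroundPropagators, (3.18)–(3.19) p.393] -/
theorem levelDisjoint_cubeLamS_top {L : ℕ} (hL : 1 ≤ L) (a : Site d) (M : ℕ) {ρ : ℕ} (hρ : L ≤ ρ) (k : ℕ) :
    LevelDisjoint L k (fun j => (cubeLamS_finite L a M ρ k k j).toFinset) (cubeFam_zero_finite L a M ρ k).toFinset :=
  levelDisjoint_cubeLamS hL a M hρ le_rfl

/-! ## §2 Member presentations (the cube sub-family's consumer index) -/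

/-- **MEMBER PRESENTATION** (`i : ZdIdx d L` with `i.Λs = cubeLamS L a M ρ i.k` — the `B8CubeMemberZd.exists_member_cube` member, `Ω_j = □_j`):
for every truncation `m ≤ i.k`, every finset presentation `Λ` of sub-classes of `i.Λs m ·` and every finite carrier `s ⊇ □₀`, `LevelDisjoint L m Λ s`.
[cite: Balaban1985BackgroundPropagators, (3.18)–(3.19) p.393; Balaban1985RegularSpaces, (1.131) p.99, (1.68) p.88] -/
theorem levelDisjoint_of_subset_Λs_of_eq {L : ℕ} (hL : 1 ≤ L) (i : ZdIdx d L) (a : Site d) (M : ℕ) {ρ : ℕ} (hρ : L ≤ ρ)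
    (hΛs : i.Λs = cubeLamS L a M ρ i.k) {m : ℕ} (hmk : m ≤ i.k) {Λ : ℕ → Finset (Site d)} {s : Finset (Site d)}
    (hΛ : ∀ j, j ≤ m → ∀ y ∈ Λ j, y ∈ i.Λs m j) (hs : cubeFam false L a M ρ i.k 0 ⊆ ↑s) : LevelDisjoint L m Λ s :=
  levelDisjoint_of_subset_cubeLamS hL a M hρ hmk (fun j hj y hy => by rw [← hΛs]; exact hΛ j hj y hy) hs

/-- **MEMBER PRESENTATION, carrier spelled through the member** (`i.Ω = cubeFam false L a M ρ i.k`, `i.Λs = cubeLamS L a M ρ i.k`): for `m ≤ i.k`,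
sub-classes `Λ` of `i.Λs m ·` and any finite `s ⊇ i.Ω 0`, `LevelDisjoint L m Λ s`.
[cite: Balaban1985BackgroundPropagators, (3.18)–(3.19) p.393; Balaban1985RegularSpaces, (1.131) p.99, (1.68) p.88] -/
theorem levelDisjoint_of_subset_Λs_of_eq' {L : ℕ} (hL : 1 ≤ L) (i : ZdIdx d L) (a : Site d) (M : ℕ) {ρ : ℕ} (hρ : L ≤ ρ)
    (hΩ : i.Ω = cubeFam false L a M ρ i.k) (hΛs : i.Λs = cubeLamS L a M ρ i.k) {m : ℕ} (hmk : m ≤ i.k)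
    {Λ : ℕ → Finset (Site d)} {s : Finset (Site d)} (hΛ : ∀ j, j ≤ m → ∀ y ∈ Λ j, y ∈ i.Λs m j) (hs : i.Ω 0 ⊆ ↑s) :
    LevelDisjoint L m Λ s :=
  levelDisjoint_of_subset_Λs_of_eq hL i a M hρ hΛs hmk hΛ (by rw [← hΩ]; exact hs)


/-! ## §3 The consequences at the cube member: separating sites and «`Q′` onto» for every background -/

section Consequences

variable {𝔸 : Type*} [CStarAlgebra 𝔸]

/-- ★ **SEPARATING SITES AT THE CUBE MEMBER, SHAPE-FREE** ([B9] (3.18)–(3.19)): for EVERY background of units `U₀` on `ℤᵈ`, every truncation `m ≤ k`,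
every finset presentation `Λ` of sub-classes of `cubeLamS … m ·` and every finite carrier `s ⊇ □₀` (`0 < L ≤ ρ`), `B9Eq325QGGQInvZd.SeparatingSites L U₀ m Λ s`
— n06-w4's `separatingSites_of_levelDisjoint` at the cube clause of §1. [cite: Balaban1985BackgroundPropagators, (3.18)–(3.19) p.393, (3.25) p.394; Balaban1985RegularSpaces, (1.131) p.99] -/
theorem separatingSites_of_subset_cubeLamS {L : ℕ} [NeZero L] (a : Site d) (M : ℕ) {ρ : ℕ} (hρ : L ≤ ρ) {k m : ℕ} (hm : m ≤ k)
    {Λ : ℕ → Finset (Site d)} {s : Finset (Site d)} (hΛ : ∀ j, j ≤ m → ∀ y ∈ Λ j, y ∈ cubeLamS L a M ρ k m j)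
    (hs : cubeFam false L a M ρ k 0 ⊆ ↑s) (U₀ : Site d → Fin d → 𝔸ˣ) : SeparatingSites L U₀ m Λ s :=
  separatingSites_of_levelDisjoint U₀
    (levelDisjoint_of_subset_cubeLamS (Nat.one_le_iff_ne_zero.mpr (NeZero.ne L)) a M hρ hm hΛ hs)

/-- **SEPARATING SITES AT THE CANONICAL FINSETS** of the cube member (`Λ_j := cubeLamS … m j`, `s := □₀`), every background of units `U₀`, `m ≤ k`.
[cite: Balaban1985BackgroundPropagators, (3.18)–(3.19) p.393; Balaban1985RegularSpaces, (1.131) p.99] -/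
theorem separatingSites_cubeLamS {L : ℕ} [NeZero L] (a : Site d) (M : ℕ) {ρ : ℕ} (hρ : L ≤ ρ) {k m : ℕ} (hm : m ≤ k)
    (U₀ : Site d → Fin d → 𝔸ˣ) :
    SeparatingSites L U₀ m (fun j => (cubeLamS_finite L a M ρ k m j).toFinset) (cubeFam_zero_finite L a M ρ k).toFinset :=
  separatingSites_of_levelDisjoint U₀ (levelDisjoint_cubeLamS (Nat.one_le_iff_ne_zero.mpr (NeZero.ne L)) a M hρ hm)

/-- ★★ **«`Q′` IS ONTO» AT THE CUBE MEMBER, SHAPE-FREE**: for EVERY background of units `U₀`, Hermitian faithful `τ` on a finite-dimensional `𝔸`, every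
truncation `m ≤ k`, every finset presentation `Λ` of sub-classes of `cubeLamS … m ·` and every finite carrier `s ⊇ □₀`, the `τ`-adjoint `Q′*` of the multi-level
averaging is INJECTIVE on the level data `L²(𝔅_m, ·)` — `B9Eq325QGGQInvZd.QprimeStarInjective L U₀ τ hτp m Λ s`, the displayed hypothesis `hinj` of
`qggq_bijective ∕ cZd` (Thm 3.11's third operator `(Q′G′²Q′*)⁻¹`) and of the projection formula (3.25), DISCHARGED at the cube member of (1.131).
[cite: Balaban1985BackgroundPropagators, (3.25) p.394, Thm 3.11 p.416, (3.18)–(3.19) p.393; Balaban1985RegularSpaces, (1.131) p.99, Prop. 6 p.99] -/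
theorem qprimeStarInjective_of_subset_cubeLamS {L : ℕ} [NeZero L] [FiniteDimensional ℝ 𝔸] (a : Site d) (M : ℕ) {ρ : ℕ} (hρ : L ≤ ρ)
    {k m : ℕ} (hm : m ≤ k) {Λ : ℕ → Finset (Site d)} {s : Finset (Site d)} (hΛ : ∀ j, j ≤ m → ∀ y ∈ Λ j, y ∈ cubeLamS L a M ρ k m j)
    (hs : cubeFam false L a M ρ k 0 ⊆ ↑s) (U₀ : Site d → Fin d → 𝔸ˣ) (τ : 𝔸 →ₗ[ℂ] ℂ) (hτp : ∀ b : 𝔸, b ≠ 0 → 0 < (τ (star b * b)).re)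
    (hτs : ∀ b : 𝔸, τ (star b) = starRingEnd ℂ (τ b)) : QprimeStarInjective L U₀ τ hτp m Λ s :=
  qprimeStarInjective_of_levelDisjoint U₀ τ hτp hτs
    (levelDisjoint_of_subset_cubeLamS (Nat.one_le_iff_ne_zero.mpr (NeZero.ne L)) a M hρ hm hΛ hs)

/-- ★★ **«`Q′` IS ONTO» AT THE CANONICAL FINSETS** of the cube member (`Λ_j := cubeLamS … m j`, `s := □₀`): `Q′*` injective on `L²(𝔅_m, ·)` for every
background of units `U₀`, Hermitian faithful `τ`, finite-dimensional `𝔸`, `m ≤ k` — so `B9Eq325QGGQInvZd.cZd` (`(Q′G′²Q′*)⁻¹`) is an object there.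
[cite: Balaban1985BackgroundPropagators, (3.25) p.394, Thm 3.11 p.416; Balaban1985RegularSpaces, (1.131) p.99, Prop. 6 p.99] -/
theorem qprimeStarInjective_cubeLamS {L : ℕ} [NeZero L] [FiniteDimensional ℝ 𝔸] (a : Site d) (M : ℕ) {ρ : ℕ} (hρ : L ≤ ρ)
    {k m : ℕ} (hm : m ≤ k) (U₀ : Site d → Fin d → 𝔸ˣ) (τ : 𝔸 →ₗ[ℂ] ℂ) (hτp : ∀ b : 𝔸, b ≠ 0 → 0 < (τ (star b * b)).re)
    (hτs : ∀ b : 𝔸, τ (star b) = starRingEnd ℂ (τ b)) :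
    QprimeStarInjective L U₀ τ hτp m (fun j => (cubeLamS_finite L a M ρ k m j).toFinset) (cubeFam_zero_finite L a M ρ k).toFinset :=
  qprimeStarInjective_of_levelDisjoint U₀ τ hτp hτs (levelDisjoint_cubeLamS (Nat.one_le_iff_ne_zero.mpr (NeZero.ne L)) a M hρ hm)

end Consequences

end Literature.MathematicalPhysics.QuantumFieldTheory.Balaban1983to89.B8CubeMemberLevelDisjoint
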